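import Summits.BirchSwinnertonDyer.BirchSwinnertonDyer.Theses.InertBadSignedBranches
import Summits.BirchSwinnertonDyer.Rank1Residual.X12.InertBadThreeInstancesATamagawa
import Summits.BirchSwinnertonDyer.Rank1Residual.X12.InertBadLocalTypesThree
import Summits.BirchSwinnertonDyer.Rank1Residual.X12.ClassClosureO10RubinEta
import Literature.NumberTheory.EllipticCurves.NoEverywhereGoodReductionRat
import HarnessLib

/-!
# Route `InertBadSignedBranches` (rung K8), D71 child `InertBadAtThreeIstarZero` (stmt-BirchSwinnertonDyer-19656):
# the MEMBERSHIP LAW of the type `(3, I₀*)` off `j = 1728`, and a second relative witness in the CM field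
# `ℚ(√−7)` — `441d1 = 49a1^{(−3)}` (helper `--supports` 19656; cell `bsd-cm`, seat `bsd-cm-k8i-c41` g3; nothing asserted)

HONEST FRAMING (cell `bsd-cm`, run/shared/lean/pub/bsd-cm/): Birch–Swinnerton-Dyer is NOT proved by
any of this. The item `InertBadAtThreeIstarZero` (for EVERY globally minimal CM curve of signed local
type `(3, I₀*)` and analytic rank one, `Typed.X12.MissingInputAt W 3`) is OPEN at class level and stays
so (it is `BSD₃`'s last clause on the type; the main-conjecture half at the additive prime `3` is in no
source — seats g0/g2 of this base, memos K8-AT3-STRUCTURE / -g2). THEOREMS ONLY: 0 definitions, 0 named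
facts minted, 0 `sorry`.

PARTITION (D-0054): CornerF inert-bad (B12 / O10) × O10-PS@3 = the 57 census classes of signed type
`(3, I₀*)` (§1: the type as a SET is «CM, `3` inert, bad at `3`, `j ≠ 1728`» ⊔ its `j = 1728` members) ×
`p = 3` — types-the-object-of; the pair (`441d1`, `3`) ∈ O10-PS@3 with `d_K = −7` exhibited (§2–§4);
closes no cell, books nothing, moves no mark.

## What is here

* §1 `hasSignedLocalType_three_IstarZero_of_j_ne_1728` — **membership law**: a CM curve `W/ℚ` with `3`
  INERT in the CM field, BAD at `3` and `j(W) ≠ 1728` HAS signed local type `(3, I₀*)` (x1b gen 24's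
  Kodaira classification at the place over `3`, `X12.hasGoodReductionAt_or_kodairaSymbolAt_of_hasCM_three`:
  good, or `j = 1728` with `III / I₀* / III*`, or `j ∉ {0, 1728}` with `I₀*`; `j = 0` is `ℚ(√−3)`,
  ramified at `3`). With the `iff` form and the consequence for the D71 split:
  `missingInputAt_three_of_inertBadAtThreeIstarZero_of_j_ne_1728` — **the child 19656 ALONE delivers the
  parent's conclusion `Typed.X12.MissingInputAt W 3` at every inert-bad-at-`3` CM curve with `j ≠ 1728`**
  (all CM fields `ℚ(√−7), ℚ(√−19), ℚ(√−43), ℚ(√−67), ℚ(√−163)` and the order `ℤ[2i]`); the HELD sibling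
  19657 is exactly the `j = 1728` quartic-twist corner (k8i-c42's
  `InertBadOffLowerHalf.j_eq_1728_and_hasSignedLocalType_of_offIstarZero`, the converse direction).
* §2 `hasSignedLocalType_cremona441d1_three` — x1b's record model `441d1 = [1, −1, 1, −20, 46]`
  (`j = −3375`, CM by `ℤ[(1+√−7)/2]`, `Δ = −3⁶·7³`, globally minimal) IS of signed local type `(3, I₀*)`:
  UNCONDITIONAL (kernel) — by §1, CM / `3` inert from `j = −3375`, bad at `3` from `3 ∣ Δ_min`.
  A second BC5-style member after g0's `E₁₅ = 7200bg1` (p418526), in a second CM field, and in the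
  `(H_Δ)`-FAILING regime of N22 Remark F at `3` (`φ_K(𝔮₇) = 6`; census CENSUS-PI-AT-3, evidence #8 on 19656).
* §3 `missingInputAt_three_cremona441d1` — the child's conclusion AT the member GIVEN the eight published
  facts of x1b's T-KR@3 record, Cremona's two Manin sentences and the certified data `r_an = 1`,
  `#Ш_an = q` with `ord₃ q = 0` (Cremona `allbsd`: `#Ш_an(441d1) = 1`) — from the Tamagawa-free record
  `X12.bsdp_three_cremona441d1_tam` (`∏ c_ℓ = 4` in the kernel) by bookkeeping (`Ш` finite by GZK).
* §4 `inertBadAtThreeIstarZero_at_cremona441d1` — both packaged in the item's own shape at the member.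

References (locators only): [Cremona1997] Table 1 / `allbsd` (curve 441d1: `[1,−1,1,−20,46]`, `r = 1`,
`#Ш_an = 1`, `∏ c_ℓ = 4`); [SilvermanATAEC1994] IV.9.4, Table 4.1, App. A §3; [SilvermanAEC2009] VII.5
Prop. 5.1(a), X.5 Prop. 5.4; [MatarNekovar2019] Thm. 0.3, §0.11; [AgasheRibetStein2006] Thm. 2.6,
appendix Thm. 5.2; [Miller2011LMS] §1, Def. 1.1.
-/

set_option autoImplicit false
set_option linter.dupNamespace false

noncomputable section

open scoped Classical NumberField

open WeierstrassCurve NumberField IsDedekindDomain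
open Literature.NumberTheory.EllipticCurves
open Literature.NumberTheory.EllipticCurves.ModularForms
open Literature.NumberTheory.EllipticCurves.Rank1Residual
open Literature.NumberTheory.EllipticCurves.Rank1Residual.Typed
open Literature.NumberTheory.EllipticCurves.AgasheRibetStein2006
open Summit.BirchSwinnertonDyer.Rank1Residual
open Summit.BirchSwinnertonDyer.Rank1Residual.X12
open Summit.BirchSwinnertonDyer.Rank1Residual.X12.O10

namespace Summit.BirchSwinnertonDyer.BirchSwinnertonDyer.Theorems.InertBadAtThreeWitness

/-! ## §1 Membership law: the type `(3, I₀*)` contains every inert-bad-at-`3` CM curve with `j ≠ 1728` -/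

/-- **Membership law of the type `(3, I₀*)`.** A CM curve `W/ℚ` with `3` INERT in the CM field
(`CMInert W 3`), BAD at `3` and `j(W) ≠ 1728` has signed local type `(3, I₀*)`: at the place over `3`
x1b's classification (`X12.hasGoodReductionAt_or_kodairaSymbolAt_of_hasCM_three`) leaves «good» (excluded
by `¬ Good W 3`), «`j = 1728` and `III / I₀* / III*`» (excluded by `j ≠ 1728`), or «`j ∉ {0, 1728}` and
`I₀*`». So off `j = 1728` the inert-bad corner at `3` IS the type `(3, I₀*)` — every CM field
`ℚ(√−7), ℚ(√−19), ℚ(√−43), ℚ(√−67), ℚ(√−163)` and the order `ℤ[2i]` (`j = 287496`) included.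
UNCONDITIONAL. [cite: SilvermanATAEC1994, IV.9.4, Table 4.1 and App. A §3] [cite: SilvermanAEC2009, X.5 Prop. 5.4] -/
theorem hasSignedLocalType_three_IstarZero_of_j_ne_1728 (W : WeierstrassCurve ℚ) [W.IsElliptic]
    [Fact (Nat.Prime 3)] (hCM : W.HasCM) (hin : CMInert W 3) (hbad : ¬ Good W 3) (hj : W.j ≠ 1728) :
    HasSignedLocalType W 3 (.Istar 0) := by
  refine ⟨hCM, hin, hbad, fun v hv ↦ ?_⟩
  have hbad' : ¬ W.HasGoodReductionAt v := by
    rwa [← X12.good_iff_hasGoodReductionAt W 3 v hv]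
  rcases X12.hasGoodReductionAt_or_kodairaSymbolAt_of_hasCM_three W hCM v hv hin.1 with
      h | ⟨h1728, -⟩ | ⟨-, -, hk⟩
  · exact absurd h hbad'
  · exact absurd h1728 hj
  · exact hk

/-- **The `iff` form off `j = 1728`**: for a CM curve with `j ≠ 1728`, signed local type `(3, I₀*)` ⟺
`3` inert in the CM field and bad at `3`. [cite: SilvermanATAEC1994, IV.9.4, Table 4.1 and App. A §3] -/
theorem hasSignedLocalType_three_IstarZero_iff_of_j_ne_1728 (W : WeierstrassCurve ℚ) [W.IsElliptic]
    [Fact (Nat.Prime 3)] (hCM : W.HasCM) (hj : W.j ≠ 1728) :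
    HasSignedLocalType W 3 (.Istar 0) ↔ CMInert W 3 ∧ ¬ Good W 3 :=
  ⟨fun hT ↦ ⟨hT.2.1, hT.2.2.1⟩,
    fun ⟨hin, hbad⟩ ↦ hasSignedLocalType_three_IstarZero_of_j_ne_1728 W hCM hin hbad hj⟩

/-- **Consequence for the D71 split: the child 19656 ALONE delivers the parent's conclusion off
`j = 1728`.** Given `InertBadAtThreeIstarZero`, every globally minimal CM curve of analytic rank one with
`3` inert in the CM field, bad at `3` and `j ≠ 1728` has `Typed.X12.MissingInputAt W 3` — the binder
shape of the parent `InertBadAtThree` with `j ≠ 1728` in place of nothing; the HELD sibling 19657 carries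
exactly the `j = 1728` quartic twists (types `III / III*`). Bookkeeping on §1; CONDITIONAL on the child
(OPEN); nothing booked. [cite: SilvermanATAEC1994, IV.9.4, Table 4.1 and App. A §3] [cite: Miller2011LMS, Def. 1.1] -/
theorem missingInputAt_three_of_inertBadAtThreeIstarZero_of_j_ne_1728
    (h : Summit.BirchSwinnertonDyer.BirchSwinnertonDyer.Theses.InertBadSignedBranches.InertBadAtThreeIstarZero)
    (W : WeierstrassCurve ℚ) [W.IsElliptic] [W.IsGloballyMinimal] [Fact (Nat.Prime 3)]
    (hCM : W.HasCM) (hr : W.analyticRank = 1) (hin : CMInert W 3) (hbad : ¬ Good W 3)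
    (hj : W.j ≠ 1728) : X12.MissingInputAt W 3 :=
  h W (hasSignedLocalType_three_IstarZero_of_j_ne_1728 W hCM hin hbad hj) hr

/-! ## §2 The member `441d1` (`j = −3375`, `K = ℚ(√−7)`, `3` inert, Kodaira `I₀*` at `3`) — UNCONDITIONAL -/

/-- `Δ(441d1) = −250047 = −3⁶·7³` for x1b's record model `[1, −1, 1, −20, 46]`.
[cite: Cremona1997, Table 1 (curve 441d1)] -/
theorem cremona441d1_Δ_eq : Records.cremona441d1.Δ = -250047 := by
  norm_num [Records.cremona441d1, WeierstrassCurve.Δ, WeierstrassCurve.b₂, WeierstrassCurve.b₄,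
    WeierstrassCurve.b₆, WeierstrassCurve.b₈]

/-- **`441d1` is BAD at `3`**: the record model is globally minimal (x1b, Kraus) and `3 ∣ Δ = −3⁶·7³`,
so the place over `3` is not of good reduction (tree
`not_hasGoodReductionAtPrime_of_dvd_minimalDiscriminantInt`). UNCONDITIONAL.
[cite: SilvermanAEC2009, VII.5 Prop. 5.1(a) and VII.1 Prop. 1.3(b)] -/
theorem not_good_cremona441d1_three [Fact (Nat.Prime 3)] : ¬ Good Records.cremona441d1 3 := by
  refine not_hasGoodReductionAtPrime_of_dvd_minimalDiscriminantInt Records.cremona441d1 3 ?_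
  have h : (minimalDiscriminantInt Records.cremona441d1 : ℚ) = ((-250047 : ℤ) : ℚ) := by
    rw [cast_minimalDiscriminantInt, cremona441d1_Δ_eq]; norm_num
  rw [Int.cast_inj.mp h]
  norm_num

/-- **`441d1` has signed local type `(3, I₀*)`** — CM by `ℤ[(1+√−7)/2]` and `3` INERT in `ℚ(√−7)`
(both read off `j = −3375`: `hasCM_of_j_eq_neg3375`, `X12.cmInert_three_of_j_eq_neg3375`), bad at `3`
(`not_good_cremona441d1_three`), and Kodaira `I₀*` at the place over `3` by the membership law §1
(`j = −3375 ≠ 1728`). UNCONDITIONAL (kernel). The pair (`441d1`, `3`) is one of the 57 O10-PS@3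
census classes (N18 §1; `d_K = −7`). [cite: SilvermanATAEC1994, IV.9.4, Table 4.1 and App. A §3]
[cite: Cremona1997, Table 1 (curve 441d1)] -/
theorem hasSignedLocalType_cremona441d1_three [Fact (Nat.Prime 3)] :
    HasSignedLocalType Records.cremona441d1 3 (.Istar 0) :=
  hasSignedLocalType_three_IstarZero_of_j_ne_1728 Records.cremona441d1
    (hasCM_of_j_eq_neg3375 _ Records.cremona441d1_j)
    (X12.cmInert_three_of_j_eq_neg3375 Records.cremona441d1 Records.cremona441d1_j)
    not_good_cremona441d1_three (by rw [Records.cremona441d1_j]; norm_num)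

/-! ## §3 The child's conclusion AT the member (T-KR@3 form) -/

/-- **The child's conclusion at `(441d1, 3)`: `Typed.X12.MissingInputAt 441d1 3`** — GIVEN the published
facts of x1b's record (Gross–Zagier `hGZ`, Kolyvagin `hKo`, Matar–Nekovář Thm 0.3 `hMN`, GZK `hGZK`,
modularity `hmod`/`hnf`, Friedberg–Hoffstein `hFH`, the CM rank-zero triple `hCM8`), Cremona's Manin
sentences (`h26`/`h52`), and the certified data `r_an(441d1) = 1` (`hr`) and `#Ш(441d1)_an = q`,
`ord₃ q = 0` (`hq`, `hv`; Cremona: `#Ш_an = 1`). Proof: x1b's Tamagawa-free record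
`X12.bsdp_three_cremona441d1_tam` gives `BSD(441d1, 3)`; `Ш(441d1)` is finite by GZK in analytic rank one;
bookkeeping (`missingPPartAt_of_bsdp`). RELATIVE (per-pair known regime); CONDITIONAL on every displayed
hypothesis; nothing booked; 19656 stays OPEN at class level.
[cite: Cremona1997, Table 1 (curve 441d1: r = 1, #Ш_an = 1)] [cite: MatarNekovar2019, Thm. 0.3 and §0.11]
[cite: AgasheRibetStein2006, Thm. 2.6 and appendix Thm. 5.2] [cite: Miller2011LMS, §1 and Def. 1.1] -/
theorem missingInputAt_three_cremona441d1 [Fact (Nat.Prime 3)]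
    (hGZ : ∀ (N : ℕ) [NeZero N] (W : WeierstrassCurve ℚ) (K : Type) [Field K] [NumberField K],
      gross_zagier N W K)
    (hKo : ∀ (N : ℕ) [NeZero N] (W : WeierstrassCurve ℚ) (K : Type) [Field K] [NumberField K],
      kolyvagin N W K)
    (hMN : ∀ (N : ℕ) [NeZero N] (W : WeierstrassCurve ℚ) (K : Type) [Field K] [NumberField K],
      MatarNekovar2019.thm03_padicValNat_card_sha_le_of_irreducible N W K)
    (hGZK : rank_eq_analyticRank_of_analyticRank_le_one) (hmod : hasEntireLFunction_rat)
    (hnf : exists_isNewformOf) (hFH : friedbergHoffstein_exists_heegnerField_split_twist_ne_zero)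
    (hCM8 : bsdTriple_of_hasCM_of_L_one_ne_zero)
    (h26 : cremona_abs_maninConstant_eq_one_of_level_le) (h52 : cremona_optimal_curveOne_x12Three)
    (hr : Records.cremona441d1.analyticRank = 1)
    {q : ℚ} (hq : shaAn Records.cremona441d1 = (q : ℂ)) (hv : padicValRat 3 q = 0) :
    X12.MissingInputAt Records.cremona441d1 3 := by
  intro _
  haveI : Finite Records.cremona441d1.sha := (hGZK Records.cremona441d1 (by rw [hr])).2
  exact missingPPartAt_of_bsdp Records.cremona441d1 3
    (bsdp_three_cremona441d1_tam hGZ hKo hMN hGZK hmod hnf hFH hCM8 h26 h52 hr hq hv)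

/-! ## §4 Packaged in the item's own shape at the member -/

/-- **BC5-style RELATIVE WITNESS for the child `InertBadAtThreeIstarZero` at the member `(441d1, 3)`**
(CM field `ℚ(√−7)`): the member IS of signed local type `(3, I₀*)` (unconditional), and — given the
published facts of the sibling's per-pair record, Cremona's Manin sentences and the certified `3`-adic
unit `#Ш(441d1)_an` — the item's implication `r_an = 1 → Typed.X12.MissingInputAt 441d1 3` holds at it.
Regime honesty: the conclusion is derived from the per-pair T-KR@3 closure (inside the known regime by
construction), not from the signed-branch chain; the class-level child stays OPEN; nothing booked.
[cite: Cremona1997, Table 1 (curve 441d1)] [cite: MatarNekovar2019, Thm. 0.3 and §0.11]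
[cite: SilvermanATAEC1994, IV.9.4 and Table 4.1] [cite: Miller2011LMS, §1 and Def. 1.1] -/
theorem inertBadAtThreeIstarZero_at_cremona441d1 [Fact (Nat.Prime 3)]
    (hGZ : ∀ (N : ℕ) [NeZero N] (W : WeierstrassCurve ℚ) (K : Type) [Field K] [NumberField K],
      gross_zagier N W K)
    (hKo : ∀ (N : ℕ) [NeZero N] (W : WeierstrassCurve ℚ) (K : Type) [Field K] [NumberField K],
      kolyvagin N W K)
    (hMN : ∀ (N : ℕ) [NeZero N] (W : WeierstrassCurve ℚ) (K : Type) [Field K] [NumberField K],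
      MatarNekovar2019.thm03_padicValNat_card_sha_le_of_irreducible N W K)
    (hGZK : rank_eq_analyticRank_of_analyticRank_le_one) (hmod : hasEntireLFunction_rat)
    (hnf : exists_isNewformOf) (hFH : friedbergHoffstein_exists_heegnerField_split_twist_ne_zero)
    (hCM8 : bsdTriple_of_hasCM_of_L_one_ne_zero)
    (h26 : cremona_abs_maninConstant_eq_one_of_level_le) (h52 : cremona_optimal_curveOne_x12Three)
    {q : ℚ} (hq : shaAn Records.cremona441d1 = (q : ℂ)) (hv : padicValRat 3 q = 0) :
    HasSignedLocalType Records.cremona441d1 3 (.Istar 0) ∧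
      (Records.cremona441d1.analyticRank = 1 → X12.MissingInputAt Records.cremona441d1 3) :=
  ⟨hasSignedLocalType_cremona441d1_three,
    fun hr ↦ missingInputAt_three_cremona441d1 hGZ hKo hMN hGZK hmod hnf hFH hCM8 h26 h52 hr hq hv⟩

end Summit.BirchSwinnertonDyer.BirchSwinnertonDyer.Theorems.InertBadAtThreeWitness

end
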